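import Mathlib
import HarnessLib
import Summits.Ventures.LatticeQCDFlow.Exactness.ExactStepBoxMinorised
import Summits.Ventures.LatticeQCDFlow.Exactness.RefreshScan
import Summits.Ventures.LatticeQCDFlow.Exactness.PiGroupKicks

/-!
# One Doeblin certificate for a whole FAMILY of updates sharing a box minorant — uniform constants across step sizes, followed by any exact step

HONEST FRAMING: exact (Metropolis-corrected) sampling algorithms for lattice gauge theory;
figures of merit are autocorrelation/cost numbers at stated couplings and volumes; no
continuum-physics claim.

Venture `LatticeQCDFlow` (cell pub-lqcd), topic `Exactness`, FANOUT row 9 (eng-latcore, GEN-24).  NEW WORK of the cell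
over the tree (`ExactStepBoxMinorised.spreads_of_box_minorised`, `SpreadingKernelDoeblin.exists_nHit_comp_minorised`,
`HaarBoxMinorants.mulWalk_pi_restrict_box`, `RefreshScan.comp_minorised`, `PiGroupKicks.smul_nHit_le_nHit`, `mulWalk`).
Nothing is cited as a fact; no number is claimed.

WHY.  GEN-23's `exactStep_nHit_minorised_of_box_minorised` (`SUNJitteredHMCCertificates.lean` §0) turns a box minorant
`κ • Haar^{⊗ι}|_{box_V(U)} ≤ K(U, ·)` into a certificate `a • π ≤ (P ∘ₖ K)^{m}(U, ·)` — per kernel, with `(m, a)`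
existential, so two step sizes get two unrelated certificates.  GEN-24's `SUNLeapfrogHMCUniformMinorant.lean` gives ONE
`(V, κ)` for every trajectory length in `[τ₁, τ₂]`.  This file shows the certificate is then uniform too: `(m, a)` can be
chosen ONCE for the whole family — so every downstream constant (the `B` in `τ_int ≤ 1/2 + B/(1 − π(A))`, burn-in
`B/n`, decorrelation rate, finite-sample bands) is ONE number for all lengths in the interval: the certified figures
of merit do not degenerate as the production length is tuned inside a short compact range.

THE DEVICE.  The box minorant IS itself a kernel (def-free here): `K₀(U, ·) = κ • Haar^{⊗ι}|_{box_V(U)} = mulWalk (κ • Haar^{⊗ι}|_{V^ι}) U`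
(right translation of one fixed finite measure).  Apply the tree's two theorems ONCE to `K₀` (they never needed `K` to
be Markov), and push the certificate up to every `K_s ≥ K₀` by monotonicity of composition and powers.

## Content (`G` compact connected second-countable pseudo-metrisable group, `π_w = Z⁻¹ w · Haar^{⊗ι}`, `0 < m ≤ w ≤ M`)

* `mulWalk_smul_pi_restrict_box` — the box minorant is itself a kernel (a right-translation walk).
* **`exactStep_nHit_minorised_uniform_of_box_minorised`** — if `κ • Haar^{⊗ι}|_{box_V(U)} ≤ K_s(U, ·)` for every
  member `s ∈ S` of a family and every `U` (one open `V ∋ 1`, one `κ ≠ 0`), then for every Markov `P` leaving `π_w`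
  invariant there are ONE `mm` and ONE `a ≠ 0` with `a • π_w ≤ (P ∘ₖ K_s)^{mm+1}(U, ·)` for EVERY `s ∈ S` and EVERY `U`.
* **`nHit_minorised_uniform_of_box_minorised`** — the same for the family alone (`P = id`).
* **`exactStep_uniformlyErgodic_uniform_of_box_minorised`** — hence ONE geometric rate `(1 − δ)^{⌊t/(mm+1)⌋}` of
  total-variation convergence from every start for EVERY member (each Markov, `π_w`-invariant), and uniqueness.

NOT CLAIMED: any value of `(mm, a)`; instances (the engine's fixed-step HMC over a length interval is the next file,
`SUNLeapfrogHMCUniformCertificates.lean`, gated on `SUNLeapfrogHMCUniformMinorant`'s olean).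
-/

noncomputable section

namespace Summit.Ventures.LatticeQCDFlow.Exactness

open MeasureTheory Measure Metric Set Filter Topology Function ProbabilityTheory ProbabilityTheory.Kernel
open Literature.MathematicalPhysics.QuantumFieldTheory (haarProbability)
open scoped ENNReal

set_option backward.isDefEq.respectTransparency false

section BoxKernel

variable {ι : Type*} [Fintype ι] {G : Type*} [TopologicalSpace G] [Group G] [IsTopologicalGroup G]
  [CompactSpace G] [MeasurableSpace G] [BorelSpace G] [SecondCountableTopology G]

/-- **The box minorant is itself a kernel**: the right-translation walk driven by the finite measure
`κ • Haar^{⊗ι}|_{V^ι}` sends `U` to `κ • Haar^{⊗ι}|_{ {W | ∀ j, W_j U_j⁻¹ ∈ V} }`. -/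
theorem mulWalk_smul_pi_restrict_box (κ : ℝ≥0∞) (V : Set G) (U : ι → G) :
    mulWalk (κ • (Measure.pi fun _ : ι => haarProbability G).restrict (Set.pi univ fun _ => V)) U =
      κ • (Measure.pi fun _ : ι => haarProbability G).restrict {W | ∀ j, W j * (U j)⁻¹ ∈ V} := by
  rw [mulWalk_apply, Measure.map_smul, ← mulWalk_apply, mulWalk_pi_restrict_box]

end BoxKernel

section Uniform

variable {ι : Type*} [Fintype ι] {G : Type*} [TopologicalSpace G] [Group G] [IsTopologicalGroup G]
  [CompactSpace G] [MeasurableSpace G] [BorelSpace G] [SecondCountableTopology G]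
  [TopologicalSpace.PseudoMetrizableSpace G] [ConnectedSpace G] {w : (ι → G) → ℝ} {m M : ℝ}

/-- **ONE CERTIFICATE FOR A WHOLE FAMILY OF BOX-MINORISED UPDATES FOLLOWED BY ANY EXACT STEP.**  `G` compact connected
second-countable pseudo-metrisable; `π_w = Z⁻¹ w · Haar^{⊗ι}` with `0 < m ≤ w ≤ M`; a family `K : S → Kernel` with
`κ • Haar^{⊗ι}|_{box_V(U)} ≤ K_s(U, ·)` for EVERY `s ∈ S` and every `U` (ONE open `V ∋ 1`, ONE `κ ≠ 0`); `P` ANY Markov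
kernel leaving `π_w` invariant.  Then there are `mm` and `a ≠ 0` — the SAME for all members — with
`a • π_w ≤ (P ∘ₖ K_s)^{mm+1}(U, ·)` for EVERY `s ∈ S` and EVERY `U`. -/
theorem exactStep_nHit_minorised_uniform_of_box_minorised (hm : 0 < m) (hwm : ∀ U, m ≤ w U) (hwM : ∀ U, w U ≤ M)
    {S : Type*} {T : Set S} {K : S → Kernel (ι → G) (ι → G)} {V' : Set G} (hV'o : IsOpen V') (hV'1 : (1 : G) ∈ V')
    {κ : ℝ≥0∞} (hκ : κ ≠ 0)
    (hbox : ∀ s ∈ T, ∀ U : ι → G,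
      κ • (Measure.pi fun _ : ι => haarProbability G).restrict {W | ∀ j, W j * (U j)⁻¹ ∈ V'} ≤ K s U)
    (P : Kernel (ι → G) (ι → G)) [IsMarkovKernel P]
    (hP : Invariant P (gibbsProbability (Measure.pi fun _ : ι => haarProbability G) w)) :
    ∃ mm : ℕ, ∃ a : ℝ≥0∞, a ≠ 0 ∧ ∀ s ∈ T, ∀ U : ι → G,
      a • gibbsProbability (Measure.pi fun _ : ι => haarProbability G) w ≤ nHit (P ∘ₖ K s) (mm + 1) U := by
  letI : PseudoMetricSpace G := TopologicalSpace.pseudoMetrizableSpacePseudoMetric G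
  -- the box minorant itself, as the kernel `K₀`
  have hbox₀ : ∀ U : ι → G, κ • (Measure.pi fun _ : ι => haarProbability G).restrict {W | ∀ j, W j * (U j)⁻¹ ∈ V'} ≤
      mulWalk (κ • (Measure.pi fun _ : ι => haarProbability G).restrict (Set.pi univ fun _ => V')) U := fun U => by
    rw [mulWalk_smul_pi_restrict_box]
  obtain ⟨r, hr, c, hc, hK₀, hpos⟩ := spreads_of_box_minorised (ι := ι) hm hwm hwM hV'o hV'1 hκ hbox₀
  haveI := isProbabilityMeasure_gibbsProbability (μ := Measure.pi fun _ : ι => haarProbability G) hm hwm hwM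
  obtain ⟨mm, a, ha, hmin⟩ := exists_nHit_comp_minorised hP hr hc hK₀ hpos
  refine ⟨mm, a, ha, fun s hs U => (hmin U).trans ?_⟩
  -- monotonicity: `K₀ ≤ K_s` statewise ⇒ `(P ∘ₖ K₀)^{mm+1} ≤ (P ∘ₖ K_s)^{mm+1}` statewise
  have hle : ∀ U', (1 : ℝ≥0∞) •
      (P ∘ₖ mulWalk (κ • (Measure.pi fun _ : ι => haarProbability G).restrict (Set.pi univ fun _ => V'))) U' ≤
      (P ∘ₖ K s) U' := fun U' => by
    have h := comp_minorised (κ := K s)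
      (Φ := mulWalk (κ • (Measure.pi fun _ : ι => haarProbability G).restrict (Set.pi univ fun _ => V')))
      (κ' := P) (Φ' := P) (ε := 1) (ε' := 1)
      (fun a => by rw [one_smul, mulWalk_smul_pi_restrict_box]; exact hbox s hs a) (fun a => by rw [one_smul]) U'
    rwa [one_mul] at h
  have h := smul_nHit_le_nHit hle (mm + 1) U
  rwa [one_pow, one_smul] at h

/-- **THE SAME FOR THE FAMILY ALONE** (`P = id`): ONE `(mm, a)` with `a • π_w ≤ K_s^{mm+1}(U, ·)` for every `s ∈ S`,
every `U`. -/
theorem nHit_minorised_uniform_of_box_minorised (hm : 0 < m) (hwm : ∀ U, m ≤ w U) (hwM : ∀ U, w U ≤ M)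
    {S : Type*} {T : Set S} {K : S → Kernel (ι → G) (ι → G)} {V' : Set G} (hV'o : IsOpen V') (hV'1 : (1 : G) ∈ V')
    {κ : ℝ≥0∞} (hκ : κ ≠ 0)
    (hbox : ∀ s ∈ T, ∀ U : ι → G,
      κ • (Measure.pi fun _ : ι => haarProbability G).restrict {W | ∀ j, W j * (U j)⁻¹ ∈ V'} ≤ K s U) :
    ∃ mm : ℕ, ∃ a : ℝ≥0∞, a ≠ 0 ∧ ∀ s ∈ T, ∀ U : ι → G,
      a • gibbsProbability (Measure.pi fun _ : ι => haarProbability G) w ≤ nHit (K s) (mm + 1) U := by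
  obtain ⟨mm, a, ha, h⟩ := exactStep_nHit_minorised_uniform_of_box_minorised (ι := ι) hm hwm hwM hV'o hV'1 hκ hbox
    Kernel.id invariant_id
  exact ⟨mm, a, ha, fun s hs U => by simpa only [Kernel.id_comp] using h s hs U⟩

/-- **ONE GEOMETRIC RATE FOR THE WHOLE FAMILY**: under the hypotheses of
`exactStep_nHit_minorised_uniform_of_box_minorised`, if moreover every `K_s` (`s ∈ T`) is Markov and leaves `π_w`
invariant, there are ONE `mm` and ONE `δ ∈ (0, 1]` with `|μ₀ (P ∘ₖ K_s)ᵗ(A) − π_w(A)| ≤ (1 − δ)^{⌊t/(mm+1)⌋}` for EVERY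
`s ∈ T`, EVERY initial law `μ₀`, every `t`, every `A` — and `π_w` is the unique invariant probability law of each `P ∘ₖ K_s`. -/
theorem exactStep_uniformlyErgodic_uniform_of_box_minorised (hm : 0 < m) (hwm : ∀ U, m ≤ w U) (hwM : ∀ U, w U ≤ M)
    {S : Type*} {T : Set S} {K : S → Kernel (ι → G) (ι → G)} [∀ s, IsMarkovKernel (K s)]
    (hKinv : ∀ s ∈ T, Invariant (K s) (gibbsProbability (Measure.pi fun _ : ι => haarProbability G) w))
    {V' : Set G} (hV'o : IsOpen V') (hV'1 : (1 : G) ∈ V') {κ : ℝ≥0∞} (hκ : κ ≠ 0)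
    (hbox : ∀ s ∈ T, ∀ U : ι → G,
      κ • (Measure.pi fun _ : ι => haarProbability G).restrict {W | ∀ j, W j * (U j)⁻¹ ∈ V'} ≤ K s U)
    (P : Kernel (ι → G) (ι → G)) [IsMarkovKernel P]
    (hP : Invariant P (gibbsProbability (Measure.pi fun _ : ι => haarProbability G) w)) :
    ∃ mm : ℕ, ∃ δ : ℝ, 0 < δ ∧ δ ≤ 1 ∧ ∀ s ∈ T,
      (∀ (μ₀ : Measure (ι → G)) [IsProbabilityMeasure μ₀] (t : ℕ) (A : Set (ι → G)),
        |((fun ν' : Measure (ι → G) => ν'.bind (P ∘ₖ K s))^[t] μ₀).real A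
            - (gibbsProbability (Measure.pi fun _ : ι => haarProbability G) w).real A| ≤ (1 - δ) ^ (t / (mm + 1))) ∧
      ∀ (π' : Measure (ι → G)) [IsProbabilityMeasure π'],
        Invariant (P ∘ₖ K s) π' → π' = gibbsProbability (Measure.pi fun _ : ι => haarProbability G) w := by
  haveI := isProbabilityMeasure_gibbsProbability (μ := Measure.pi fun _ : ι => haarProbability G) hm hwm hwM
  obtain ⟨mm, a, ha, hmin⟩ :=
    exactStep_nHit_minorised_uniform_of_box_minorised (ι := ι) hm hwm hwM hV'o hV'1 hκ hbox P hP
  -- `a ≤ 1`: evaluate the certificate of any member at `univ`; if `T` is empty the claim is vacuous with `δ = 1`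
  by_cases hT : ∃ s, s ∈ T
  · obtain ⟨s₀, hs₀⟩ := hT
    haveI : IsMarkovKernel (nHit (P ∘ₖ K s₀) (mm + 1)) := isMarkovKernel_nHit _ _
    obtain ⟨x₀⟩ := nonempty_of_isProbabilityMeasure (gibbsProbability (Measure.pi fun _ : ι => haarProbability G) w)
    have ha1 : a ≤ 1 := by
      have h1 := Measure.le_iff'.1 (hmin s₀ hs₀ x₀) univ
      rwa [Measure.smul_apply, smul_eq_mul, measure_univ, measure_univ, mul_one] at h1
    have hatop : a ≠ ⊤ := ne_top_of_le_ne_top ENNReal.one_ne_top ha1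
    refine ⟨mm, a.toReal, ENNReal.toReal_pos ha hatop,
      ENNReal.toReal_le_of_le_ofReal zero_le_one (by rwa [ENNReal.ofReal_one]), fun s hs => ⟨fun μ₀ _ t A => ?_, fun π' _ hπ' => ?_⟩⟩
    · exact uniformlyErgodic_of_nHit_minorised (hmin s hs) (hP.comp (hKinv s hs)) μ₀ t A
    · exact invariant_unique_of_minorised (κ := nHit (P ∘ₖ K s) (mm + 1)) (hmin s hs) (pos_iff_ne_zero.2 ha)
        (invariant_nHit (hP.comp (hKinv s hs)) _) (invariant_nHit hπ' _)
  · exact ⟨0, 1, one_pos, le_rfl, fun s hs => (hT ⟨s, hs⟩).elim⟩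

end Uniform

end Summit.Ventures.LatticeQCDFlow.Exactness
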